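import Mathlib.Data.List.Basic
import Mathlib.Tactic.Linarith
import HarnessLib

/-!
# Venture HSemireg — the arithmetic of the «no free step» case of the UNIT-SPREAD corollary, and
# why a closed walk never changes a slot letter exactly once

Elementary bookkeeping behind two hand steps of the computation cell `pub-hsemireg`
(PROPOSITION UNIT-SPREAD and its COROLLARY: seat w1-cx-1, `widen/W1/cx1/W1-CX-MASSEY3.md` §5ter;
reads `widen/W1/UNITSPREAD-READ-w1aut1.md` §1–§3 (seat w1-aut-1) and w1-aut-2's LEMMA SSC;
TABLE-W1 rows W1CX-36c, W1AUT-40/40b/41/42, W1AUT-B30b). There, a first-order cancelling word is a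
CLOSED WALK through a letter `x`; in each slot `k` the word has `ν_k` NON-UNIT leaves, total slot
degree `σ_k`, and must land in the output slot degree `c_k`; the COROLLARY says the word can be
non-zero only if `c_k ≤ σ_k ≤ c_k + max(0, ν_k − 2)` in every slot. Two facts are used to turn this
into KILLS by hand:

* (`noFreeStep`) if every non-unit leaf incidence in slot `k` carries degree `≥ 1` — i.e. the walk
  has NO «free step» (degree-0 letter change) in that slot, so `ν_k ≤ σ_k` — then for a mixed
  output (`c_k ≤ 1`) the corollary forces `ν_k ≤ c_k` and `σ_k = c_k`: at most ONE non-unit leaf in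
  the slot (pure arithmetic; `max(0, ν − 2)` is truncated subtraction on `ℕ`);
* (`eq_of_constant_append`, `letter_unchanged`) a closed walk cannot change a slot letter EXACTLY
  ONCE: if the slot-letter sequence is constant `a` on a non-empty initial segment and constant
  `b` on the non-empty rest, closure (first letter = last letter) forces `a = b`. Hence «at most one
  letter-changing leaf per slot» means «no letter change at all», the word is a pure-cluster word,
  and those vanish (cluster formality) — the hand death of the letters with tiny level cores
  (W1AUT-40b / LEMMA SSC).

HONEST FRAMING. Arithmetic on natural numbers and bookkeeping on finite lists only; the Lean index
of two steps of a NECESSARY-condition sieve used by the cell. No sheaf, complex, abelian variety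
or semiregularity map appears; nothing here says that HC, HC_CM or HC_AV holds, and nothing here
is a new case of anything.
-/

namespace Summit.Ventures.HSemireg

namespace UnitSpreadNoFreeStep

/-- **No free step ⇒ at most one non-unit leaf per mixed slot.** If the non-unit leaves of a
slot all carry degree `≥ 1` (`ν ≤ σ`), the output degree satisfies `c ≤ σ` and the UNIT-SPREAD
budget `σ ≤ c + (ν - 2)` (truncated subtraction = `max(0, ν − 2)`), and `c ≤ 1` (a mixed Künneth
component), then `ν ≤ c` and `σ = c`. -/
theorem noFreeStep (ν σ c : ℕ) (hνσ : ν ≤ σ) (hcσ : c ≤ σ) (hbudget : σ ≤ c + (ν - 2))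
    (hc : c ≤ 1) : ν ≤ c ∧ σ = c := by
  omega

/-- The form the sieve uses (only `ν ≤ σ` and the budget are needed): a slot with output degree
`0` has NO non-unit leaf and a slot with output degree `1` has at most one. -/
theorem noFreeStep_cases (ν σ c : ℕ) (hνσ : ν ≤ σ) (hbudget : σ ≤ c + (ν - 2)) :
    (c = 0 → ν = 0) ∧ (c = 1 → ν ≤ 1) := by
  omega

variable {α : Type*}

/-- If a list is constant `a` on a non-empty initial segment `u` and constant `b` on the
non-empty rest `v`, and its first element equals its last element, then `a = b`. -/
theorem eq_of_constant_append (u v : List α) (a b : α) (hu : ∀ x ∈ u, x = a)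
    (hv : ∀ x ∈ v, x = b) (hu0 : u ≠ []) (hv0 : v ≠ [])
    (hclosed : (u ++ v).head? = (u ++ v).getLast?) : a = b := by
  obtain ⟨a', u', rfl⟩ := List.exists_cons_of_ne_nil hu0
  rcases List.eq_nil_or_concat v with hnil | ⟨v', b', rfl⟩
  · exact absurd hnil hv0
  simp only [List.concat_eq_append] at hv hclosed ⊢
  have ha' : a' = a := hu a' (by simp)
  have hb' : b' = b := hv b' (by simp)
  have h1 : (a' :: u' ++ (v' ++ [b'])).head? = some a' := by simp
  have h2 : (a' :: u' ++ (v' ++ [b'])).getLast? = some b' := by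
    rw [show a' :: u' ++ (v' ++ [b']) = (a' :: u' ++ v') ++ [b'] by simp, List.getLast?_concat]
  rw [h1, h2] at hclosed
  rw [← ha', ← hb']
  exact Option.some.inj hclosed

/-- **A closed walk never changes a slot letter exactly once.** Slot-letter sequence of a closed
walk = a list whose first and last entries agree (the walk returns to the letter of `x`); if it
were constant `a` up to some point and constant `b ≠ a` afterwards — exactly one change — we would
contradict `eq_of_constant_append`. Stated as: under those hypotheses the two constants agree,
so there was no change at all. -/
theorem letter_unchanged (u v : List α) (a b : α) (hu : ∀ x ∈ u, x = a) (hv : ∀ x ∈ v, x = b)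
    (hu0 : u ≠ []) (hv0 : v ≠ []) (hclosed : (u ++ v).head? = (u ++ v).getLast?) :
    ∀ x ∈ u ++ v, x = a := by
  have hab : a = b := eq_of_constant_append u v a b hu hv hu0 hv0 hclosed
  intro x hx
  rcases List.mem_append.mp hx with h | h
  · exact hu x h
  · rw [hab]; exact hv x h

end UnitSpreadNoFreeStep

end Summit.Ventures.HSemireg
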